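import Summits.QuantumFields.YangMills.Theorems.IR.BlockedActivityWOfMixing
import Summits.QuantumFields.YangMills.Theorems.IR.BlockedActivityWOnset
import HarnessLib

/-!
# Crux `IR` (stmt-QuantumFields-19354), lane B «strong coupling AFTER BLOCKING»: **ACTIVITY ONSET ⇔ MIXING ONSET** — the lane's W-onset
# statements are EQUIVALENT to the universal total-variation onsets of the crux format (uncalibrated; every compact `G`)

Helper module for item `stmt-QuantumFields-19354` (`--supports`; it closes nothing), lane `ym-19354-onsetsc-p2` (g6); corollaries of
`Theorems/IR/BlockedActivityWOfMixing` (TV ⇒ W at a coarser mesh) and `Theorems/IR/BlockedActivityWOnset` (W ⇒ TV, p536667).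

* ★ `blockedActivityOnsetAtW_iff_univOnsetAt` — for every compact `G` and every lattice representation `r`:
  `BlockedActivityOnsetAtW r.ρ` (every activity radius `a > 0` is met at window `1` by some mesh, at all large `β`) **↔** the universal TV onset at
  `(G, r)` (some admissible `(n, ε)`, `ε·shellCount n < 1`, and a universal mixing mesh at all large `β`).  (`→`: `univOnsetAt_of_blockedActivityOnsetAtW`
  at `(1, 1∕3552)`; `←`: `exists_mesh_blockedActivityClassW_of_univShellCond`, the bootstrap + peeling + refinement chain of the sibling file.)
* ★ `blockedActivityOnsetSCW_iff_univOnsetSC` — the lane's SC-family construction statement `BlockedActivityOnsetSCW` **↔** the SC-restricted universal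
  onset (the hypothesis shape of `SupplierSC.onsetMixingTypicalUKPcSC_of_univOnsetSC`, p524177); `blockedActivityOnsetSCW_of_onsetMixing :
  OnsetMixing → BlockedActivityOnsetSCW` (the expired universal stub implies the lane's statement).
* Round trip (not re-stated — it would duplicate `SupplierSC.onsetMixingTypicalUKPcSC_of_univOnsetSC`): SC-universal onset ⇒ `BlockedActivityOnsetSCW`
  (this file) ⇒ `OnsetMixingTypicalUKPcSC` (`onsetMixingTypicalUKPcSC_of_blockedActivityOnsetSCW`, p536667) is the direct road's conclusion.

CONSEQUENCE FOR THE CURRENCY QUESTION (owner R-a∕R-b, g3 F1∕(iii)): in the σ-uniform, UNCALIBRATED currency the lane's class of record adds NO content to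
the crux format — «blocked activity onset» and «universal mixing onset» are the same statement.  What is NOT shown (and false by this route, see the
sibling's module doc): (1) equivalence of the NT-CALIBRATED statements (`BlockedActivityOnsetCalSCW` needs mesh `a(β)·b < T`; the upgrade loses a factor
`≍ (2n+1)(24N|β| + 4 log b + log(1∕a))` in the mesh); (2) the Typ-relativised upgrade (the hole datum is untyped).

HONEST FRAMING: equivalences between OPEN onset statements of one CONDITIONAL chain; nothing asserts any of them, nor a gap, nor Clay.  No `sorry`;
axioms ⊆ {propext, Classical.choice, Quot.sound}; no instances, no notation.
-/

set_option autoImplicit false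

noncomputable section

open Filter Topology MeasureTheory
open Literature.MathematicalPhysics.QuantumFieldTheory Literature.MathematicalPhysics.QuantumLattice
open Summit.QuantumFields.YangMills.Cruxes.IR.OnsetFormats (shellCount UnivShellCond OnsetMixing)
open Summit.QuantumFields.YangMills.Cruxes.IR.OnsetFormatsUc (OnsetMixingTypicalUKPcSC)

namespace Summit.QuantumFields.YangMills.Cruxes.IR.BlockedActivity

/-! ## §1 Per group and representation: `BlockedActivityOnsetAtW r.ρ ↔` universal TV onset -/

section PerGroup

variable (G : Type) [Group G] [TopologicalSpace G] [IsTopologicalGroup G] [CompactSpace G] [MeasurableSpace G] [BorelSpace G]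
  (r : LatticeRep G)

/-- **Universal TV onset ⇒ W-onset** (per group and representation): an admissible `(n, ε)` (`0 ≤ ε`, `ε·shellCount n < 1`) with a universal
mixing mesh at all large `β` gives, for every radius `a > 0`, a W-mesh at all large `β` (the SAME `β₂`). -/
theorem blockedActivityOnsetAtW_of_univOnsetAt
    (h : ∃ (n : ℕ) (ε : ℝ), 0 ≤ ε ∧ ε * shellCount n < 1 ∧ ∃ β₂ : ℝ, ∀ β : ℝ, β₂ ≤ β → ∃ b : ℕ, 1 ≤ b ∧ UnivShellCond r.ρ β b n ε) :
    BlockedActivityOnsetAtW r.ρ := by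
  intro a ha
  obtain ⟨n, ε, hε, hlt, β₂, hβ⟩ := h
  refine ⟨β₂, fun β hb => ?_⟩
  obtain ⟨b, hb1, hU⟩ := hβ β hb
  obtain ⟨B, hbB, -, hC⟩ := exists_mesh_blockedActivityClassW_of_univShellCond G r hb1 hε hlt hU ha
  exact ⟨B, hb1.trans hbB, hC⟩

/-- ★ **ACTIVITY ONSET ⇔ MIXING ONSET, per group and representation**: `BlockedActivityOnsetAtW r.ρ ↔ ∃ (n ε) admissible, ∃ β₂, ∀ β ≥ β₂, ∃ b ≥ 1,
UnivShellCond r.ρ β b n ε`. -/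
theorem blockedActivityOnsetAtW_iff_univOnsetAt :
    BlockedActivityOnsetAtW r.ρ ↔
      ∃ (n : ℕ) (ε : ℝ), 1 ≤ n ∧ 0 ≤ ε ∧ ε * shellCount n < 1 ∧
        ∃ β₂ : ℝ, ∀ β : ℝ, β₂ ≤ β → ∃ b : ℕ, 1 ≤ b ∧ UnivShellCond r.ρ β b n ε := by
  constructor
  · intro h
    exact ⟨1, 1 / 3552, le_rfl, by norm_num, by rw [shellCount_one]; norm_num, univOnsetAt_of_blockedActivityOnsetAtW h⟩
  · rintro ⟨n, ε, -, hε, hlt, hrest⟩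
    exact blockedActivityOnsetAtW_of_univOnsetAt G r ⟨n, ε, hε, hlt, hrest⟩

end PerGroup

/-! ## §2 The SC family: `BlockedActivityOnsetSCW ↔` SC-restricted universal onset; `OnsetMixing ⇒ BlockedActivityOnsetSCW` -/

/-- ★ **The lane's construction statement IS the SC-restricted universal onset**: `BlockedActivityOnsetSCW ↔` «for every simply connected compact
simple `G` and every `r`, some admissible `(n, ε)` with `ε·shellCount n < 1` and a universal mixing mesh at all large `β`» (the hypothesis of
`SupplierSC.onsetMixingTypicalUKPcSC_of_univOnsetSC`). -/
theorem blockedActivityOnsetSCW_iff_univOnsetSC :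
    BlockedActivityOnsetSCW ↔
      ∀ (G : Type) [Group G] [TopologicalSpace G] [IsTopologicalGroup G] [CompactSpace G],
        IsCompactSimpleLieGroup G → SimplyConnectedSpace G →
        letI : MeasurableSpace G := borel G; haveI : BorelSpace G := ⟨rfl⟩;
        ∀ r : LatticeRep G, ∃ (n : ℕ) (ε : ℝ), 1 ≤ n ∧ 0 ≤ ε ∧ ε * shellCount n < 1 ∧
          ∃ β₂ : ℝ, ∀ β : ℝ, β₂ ≤ β → ∃ b : ℕ, 1 ≤ b ∧ UnivShellCond r.ρ β b n ε := by
  constructor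
  · intro h G _ _ _ _ hG hsc
    letI : MeasurableSpace G := borel G
    haveI : BorelSpace G := ⟨rfl⟩
    intro r
    exact (blockedActivityOnsetAtW_iff_univOnsetAt G r).1 (h G hG hsc r)
  · intro h G _ _ _ _ hG hsc
    letI : MeasurableSpace G := borel G
    haveI : BorelSpace G := ⟨rfl⟩
    intro r
    exact (blockedActivityOnsetAtW_iff_univOnsetAt G r).2 (h G hG hsc r)

/-- **`OnsetMixing → BlockedActivityOnsetSCW`**: the expired universal stub (all compact simple `G`, no simple connectivity asked) implies the lane's
W-currency construction statement. -/
theorem blockedActivityOnsetSCW_of_onsetMixing (h : OnsetMixing) : BlockedActivityOnsetSCW :=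
  blockedActivityOnsetSCW_iff_univOnsetSC.2 fun G _ _ _ _ hG _ => h G hG

end Summit.QuantumFields.YangMills.Cruxes.IR.BlockedActivity

end
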